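import Summits.Ventures.YMGap.RobustBall.StarDoorZdGeometric
import Summits.Ventures.YMGap.RobustBall.UniformMassGapSUN
import Summits.Ventures.YMGap.RobustBall.UniformMassGapDim3Gauge
import Summits.Ventures.YMGap.RobustBall.MassGapOnBallZdGRowsSU3PV2
import HarnessLib

/-!
# Venture YMGap, track ROBUST-BALL (Y2) — the star door at the GEOMETRIC rate: `ℤ³` cells (`SU(2)` up to `β_W = 1/2`),
# every `N ≥ 2` (eigen modulus; `SU(3)` hypothesis-free cells), and the PV2 variance form (`SU(3)` up to `β_W = 17/50`)

HONEST FRAMING. WHAT THIS IS: a venture file (cell `pub-ymgap`, track Y2 ROBUST-BALL, seat rb-p1, theorems only): further ROWS of the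
uniform mass-gap currency `UniformMassGapOnBallZdG d N β ε₀ ε₁ R m A` through ds-2's robust star door AT THE GEOMETRIC RATE
`log(1/max(ρ₀,½))/(max R 1 + 4)` of `StarDoorZdGeometric.lean` (this seat's super-solution form of the Dobrushin–Shlosman
comparison), on the certificates ALREADY in the tree — nothing numeric is new, the same `(c, λ, ρ₀)` now yield LEGIBLE rates:
* `ℤ⁴`, `SU(2)` (schema `su2_uniformMassGapOnBallZdG_star_linear`: rate `(1 − ρ₀)/(max R 1 + 4)` when `1/2 ≤ ρ₀`): EXPLICIT frontier
  rates where the tree recorded only `∃ m > 0` — `(1/8; 37/125, 37/250)`: `(1/250)/…`; `(1/4; 11/100, 11/200)`: `(1/300)/…`; ONE rate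
  `(1/400)/(max R 1 + 4)` for ALL `0 ≤ β_W ≤ 1/3` on `MemBallZdG (3/125) (3/250) R` (`su2_uniformStar_upTo_oneThird_geometric`) and the
  `ℤ⁴` Wilson point `β_W ≤ 1/3`: `PerturbedClustering 4 2 (β_W/4) 0 ∅ ((1/400)/5) 32`.
* `ℤ³`, `SU(2)` (schema `su2_dim3_uniformMassGapOnBallZdG_star_geometric`, constant `32`): `β_W = 1/4` quarter radius
  `(57/1000, 57/2000)`: `log 2/(max R 1 + 4)` (tree: `1/38`); half radius `(57/500, 57/1000)`: `log(100/57)/…` (tree: `1/85`); ONE EXPLICIT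
  rate `(1/200)/(max R 1 + 4)` for ALL `0 ≤ β_W ≤ 1/2` on `MemBallZdG (17/500) (17/1000) R` (tree: `∃ m > 0`); the `ℤ³` Wilson point
  `β_W ≤ 1/2`: `PerturbedClustering 3 2 (β_W/4) 0 ∅ ((1/200)/5) 32`.
* every `N ≥ 2`, `d = 4`, eigen modulus (schema `suN_uniformMassGapOnBallZdG_star_eigen_geometric`, constant `16N`): `SU(3)`
  HYPOTHESIS-FREE cells at `β_W = 1/8`, quarter and half radius: both `log 2/(max R 1 + 4)` (tree: `1/26`, `1/61`), constant `48`.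
* PV2 variance form, `SU(3)` HYPOTHESIS-FREE: ONE EXPLICIT rate `(1/250)/(max R 1 + 4)` for ALL `0 ≤ β_W ≤ 17/50` on
  `MemBallZdG (11/500) (11/1000) R` (`su3_uniformStar_pv2_upTo_seventeenFiftieths_geometric`), and the `SU(3)` Wilson point.
WHAT THIS IS NOT: one-sided comparison rates in units of the door's locality radius; lattice strong coupling only, nothing about the
continuum limit or a Clay-sense mass gap.
-/

noncomputable section

open MeasureTheory Function Finset Real
open scoped NNReal
open Literature.Probability.LatticeModels
open Literature.MathematicalPhysics.QuantumLattice
open Literature.MathematicalPhysics.QuantumFieldTheory hiding ZdEdge Site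
open Literature.MathematicalPhysics.QuantumFieldTheory.Balaban1983to89.StrongCouplingDobrushinWindow
  (OneLinkKRModulus)
open Summit.QuantumFields.BalabanUV.InfraRed.StrongCouplingPoincareDoorSUN (OneLinkPoincareSUN)
open Summit.QuantumFields.BalabanUV.InfraRed.StrongCouplingVarianceDoorSUN (OneLinkVarianceBound)
open Summit.Ventures.YMGap.StarResolventDim (Delta gaugeR doorPoly gaugeR_lt_one_of_door)

namespace Summit.Ventures.YMGap.RobustBall

variable {d N : ℕ}

/-! ### `ℤ⁴`, `SU(2)`: explicit rates at the frontier (the tree recorded `∃ m > 0` only) and the segment `0 ≤ β_W ≤ 1/3` -/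

/-- **LINEAR READING OF THE SCHEMA**: with `1/2 ≤ ρ₀`, the rate `(1 − ρ₀)/(max R 1 + 4)` (`log(1/ρ₀) ≥ 1 − ρ₀`). -/
theorem su2_uniformMassGapOnBallZdG_star_linear (Kn : ℕ) {βW ε₀ ε₁ c lam E S ρ₀ : ℝ} (hβ0 : 0 ≤ βW)
    (hβ : βW ≤ 2 / 3) (hε₁ : 0 ≤ ε₁) (hE : Real.exp ε₀ ≤ E) (hS : Real.sqrt 2 ≤ S)
    (hc : E * (1 + 2 * S * ε₁) * (βW / 4) ≤ c) (hlam : S * ε₁ ≤ lam) (hθ1 : 6 * c + lam < 1) (hcd : doorPoly 4 c < 1)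
    (hρ0 : gaugeR 4 c + (lam + (6 * c + lam) ^ Kn * (16 * lam)) / (1 - (6 * c + lam)) ≤ ρ₀) (hhalf : 1 / 2 ≤ ρ₀)
    (hρ1 : ρ₀ < 1) (R : ℕ) :
    UniformMassGapOnBallZdG 4 2 (βW / 4) ε₀ ε₁ R ((1 - ρ₀) / (max R 1 + 4 : ℕ)) 32 := by
  have h := su2_uniformMassGapOnBallZdG_star_geometric Kn hβ0 hβ hε₁ hE hS hc hlam hθ1 hcd hρ0 hρ1 R
  have hD : (0 : ℝ) < ((max R 1 + 4 : ℕ) : ℝ) := by positivity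
  have hmax : max ρ₀ (1 / 2) = ρ₀ := max_eq_left hhalf
  have hrate : 1 - ρ₀ ≤ -Real.log (max ρ₀ (1 / 2)) := by
    have := one_sub_le_neg_log_max_half (ρ := ρ₀); rwa [hmax] at this ⊢
  exact h.mono le_rfl le_rfl le_rfl (div_pos (by linarith) hD) (div_le_div_of_nonneg_right hrate hD.le) le_rfl
    (by norm_num)

/-- **FRONTIER CELL `(β_W, ε) = (1/8, 37/250)`, EXPLICIT RATE `(1/250)/(max R 1 + 4)`** (received sum `≤ 249/250`; the tree's
`su2_uniformStar_frontier_oneEighth` recorded `∃ m > 0`). -/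
theorem su2_uniformStar_frontier_oneEighth_explicit (R : ℕ) :
    UniformMassGapOnBallZdG 4 2 (1 / 32) (37 / 125) (37 / 250) R ((1 / 250 : ℝ) / (max R 1 + 4 : ℕ)) 32 := by
  have e1 : (1 / 8 : ℝ) / 4 = 1 / 32 := by norm_num
  have e2 : (1 : ℝ) - 249 / 250 = 1 / 250 := by norm_num
  have h := su2_uniformMassGapOnBallZdG_star_linear 20 (βW := 1 / 8) (ε₀ := 37 / 125) (ε₁ := 37 / 250)
    (c := 59603 / 1000000) (lam := 41861 / 200000) (ρ₀ := 249 / 250) (by norm_num) (by norm_num) (by norm_num)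
    exp_le_37_125_star sqrt_two_le (by norm_num) (by norm_num) (by norm_num) (by unfold doorPoly; norm_num)
    (by unfold gaugeR Delta; norm_num) (by norm_num) (by norm_num) R
  rw [e1, e2] at h
  exact h

/-- **FRONTIER CELL `(β_W, ε) = (1/4, 11/200)`, EXPLICIT RATE `(1/300)/(max R 1 + 4)`** (received sum `≤ 299/300`). -/
theorem su2_uniformStar_frontier_oneQuarter_explicit (R : ℕ) :
    UniformMassGapOnBallZdG 4 2 (1 / 16) (11 / 100) (11 / 200) R ((1 / 300 : ℝ) / (max R 1 + 4 : ℕ)) 32 := by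
  have e1 : (1 / 4 : ℝ) / 4 = 1 / 16 := by norm_num
  have e2 : (1 : ℝ) - 299 / 300 = 1 / 300 := by norm_num
  have h := su2_uniformMassGapOnBallZdG_star_linear 20 (βW := 1 / 4) (ε₀ := 11 / 100) (ε₁ := 11 / 200)
    (c := 80621 / 1000000) (lam := 77783 / 1000000) (ρ₀ := 299 / 300) (by norm_num) (by norm_num) (by norm_num)
    exp_le_11_100_star sqrt_two_le (by norm_num) (by norm_num) (by norm_num) (by unfold doorPoly; norm_num)
    (by unfold gaugeR Delta; norm_num) (by norm_num) (by norm_num) R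
  rw [e1, e2] at h
  exact h

/-- **UP TO `β_W = 1/3`, ONE EXPLICIT RATE `(1/400)/(max R 1 + 4)`** and constant `32 n²` for every `0 ≤ β_W ≤ 1/3`, every
member of `MemBallZdG (3/125) (3/250) R` and every DLR state (received sum `≤ 399/400` along the whole segment; the tree's
`su2_uniformStar_upTo_oneThird` recorded `∃ m > 0`). -/
theorem su2_uniformStar_upTo_oneThird_geometric {βW : ℝ} (h0 : 0 ≤ βW) (h : βW ≤ 1 / 3) (R : ℕ) :
    UniformMassGapOnBallZdG 4 2 (βW / 4) (3 / 125) (3 / 250) R ((1 / 400 : ℝ) / (max R 1 + 4 : ℕ)) 32 := by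
  have e2 : (1 : ℝ) - 399 / 400 = 1 / 400 := by norm_num
  rw [← e2]
  refine su2_uniformMassGapOnBallZdG_star_linear 20 (ε₀ := 3 / 125) (ε₁ := 3 / 250) (c := 17651 / 200000)
    (lam := 16971 / 1000000) (E := 1024291 / 1000000) (S := 1.41422) (ρ₀ := 399 / 400) h0 (h.trans (by norm_num))
    (by norm_num) exp_le_3_125_star sqrt_two_le ?_ (by norm_num) (by norm_num) (by unfold doorPoly; norm_num)
    (by unfold gaugeR Delta; norm_num) (by norm_num) (by norm_num) R
  calc (1024291 / 1000000 : ℝ) * (1 + 2 * 1.41422 * (3 / 250)) * (βW / 4)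
      ≤ 1024291 / 1000000 * (1 + 2 * 1.41422 * (3 / 250)) * ((1 / 3) / 4) := by gcongr
    _ ≤ 17651 / 200000 := by norm_num

/-- **THE WILSON POINT, `SU(2)` ON `ℤ⁴`, `0 ≤ β_W ≤ 1/3`, EXPLICIT RATE**: every DLR state of `SU(2)` lattice Yang–Mills at
`β_W ≤ 1/3` ('t Hooft `β_W/4`) clusters with `PerturbedClustering … ((1/400)/5) 32` (the zero member). -/
theorem su2_wilson_clustering_upTo_oneThird_explicit {βW : ℝ} (h0 : 0 ≤ βW) (h : βW ≤ 1 / 3) :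
    PerturbedClustering 4 2 (βW / 4) 0 (fun _ => (∅ : Finset (Finset (ZdEdge 4)))) ((1 / 400 : ℝ) / 5) 32 := by
  have hball := su2_uniformStar_upTo_oneThird_geometric h0 h 0
  have e5 : ((max 0 1 + 4 : ℕ) : ℝ) = 5 := by norm_num
  rw [e5] at hball
  exact (hball.2 0 _ (memBallZdG_zero (by norm_num) (by norm_num) 0)).2

/-! ### `ℤ³`, `SU(2)` -/

/-- **SCHEMA, `SU(2)`, `d = 3`, robust star door on `ℤ³`, GEOMETRIC RATE** (hypotheses of `su2_dim3_uniformMassGapOnBallZdG_star`):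
`UniformMassGapOnBallZdG 3 2 (β_W/4) ε₀ ε₁ R (log(1/max(ρ₀,½))/(max R 1 + 4)) 32`. -/
theorem su2_dim3_uniformMassGapOnBallZdG_star_geometric (Kn : ℕ) {βW ε₀ ε₁ c lam E S ρ₀ : ℝ} (hβ0 : 0 ≤ βW)
    (hβ : βW ≤ 2 / 3) (hε₁ : 0 ≤ ε₁) (hE : Real.exp ε₀ ≤ E) (hS : Real.sqrt 2 ≤ S)
    (hc : E * (1 + 2 * S * ε₁) * (βW / 4) ≤ c) (hlam : S * ε₁ ≤ lam) (hθ1 : 4 * c + lam < 1) (hcd : doorPoly 3 c < 1)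
    (hρ0 : gaugeR 3 c + (lam + (4 * c + lam) ^ Kn * (12 * lam)) / (1 - (4 * c + lam)) ≤ ρ₀) (hρ1 : ρ₀ < 1) (R : ℕ) :
    UniformMassGapOnBallZdG 3 2 (βW / 4) ε₀ ε₁ R (-Real.log (max ρ₀ (1 / 2)) / (max R 1 + 4 : ℕ)) 32 := by
  -- adapted from `su2_dim3_uniformMassGapOnBallZdG_star`
  have hS0 : 0 ≤ S := (Real.sqrt_nonneg _).trans hS
  have hE0 : 0 ≤ E := (Real.exp_pos _).le.trans hE
  set θ : ℝ := 4 * c + lam with hθ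
  set ρ : ℝ := gaugeR 3 c + (lam + θ ^ Kn * (12 * lam)) / (1 - θ) with hρ
  have habs : |((2 : ℕ) : ℝ) * (βW / 4)| / ((2 : ℕ) : ℝ) = βW / 4 := by
    rw [abs_of_nonneg (by positivity)]
    push_cast
    ring
  have hR : |((2 : ℕ) : ℝ) * (βW / 4)| / ((2 : ℕ) : ℝ) * (2 * (((3 : ℕ) : ℝ) - 1)) ≤ 3 * βW / 2 := by
    rw [habs]; push_cast; linarith
  have hc' : (1 : ℝ) * Real.exp ε₀ * (1 + 2 * Real.sqrt ((2 : ℕ) : ℝ) * ε₁) *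
      (|((2 : ℕ) : ℝ) * (βW / 4)| / ((2 : ℕ) : ℝ)) ≤ c := by
    refine le_trans ?_ hc
    have h1 : Real.sqrt ((2 : ℕ) : ℝ) = Real.sqrt 2 := by norm_num
    rw [h1, one_mul, habs]
    have hb : 0 ≤ βW / 4 := by positivity
    calc Real.exp ε₀ * (1 + 2 * Real.sqrt 2 * ε₁) * (βW / 4) ≤ E * (1 + 2 * Real.sqrt 2 * ε₁) * (βW / 4) := by
          gcongr
      _ ≤ E * (1 + 2 * S * ε₁) * (βW / 4) := by gcongr
  have hlam' : Real.sqrt ((2 : ℕ) : ℝ) * ε₁ ≤ lam := by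
    have h1 : Real.sqrt ((2 : ℕ) : ℝ) = Real.sqrt 2 := by norm_num
    rw [h1]; exact le_trans (mul_le_mul_of_nonneg_right hS hε₁) hlam
  have hθ' : θ = (2 * ((3 : ℕ) : ℝ) - 2) * c + lam := by rw [hθ]; push_cast; ring
  have hρ' : ρ = gaugeR 3 c + (lam + θ ^ Kn * (4 * ((3 : ℕ) : ℝ) * lam)) / (1 - θ) := by rw [hρ]; push_cast; ring
  have h32 : (16 * ((2 : ℕ) : ℝ) : ℝ) = 32 := by norm_num
  rw [← h32]
  exact uniformMassGapOnBallZdG_of_robustStar_geometric (d := 3) (N := 2) (by norm_num) (by norm_num) zero_le_one hR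
    (su2_quarterModulus hβ) hε₁ hc' hlam' hθ' hθ1 hcd hρ' hρ0 hρ1

/-- **LINEAR READING, `ℤ³`** (`1/2 ≤ ρ₀`): rate `(1 − ρ₀)/(max R 1 + 4)`, constant `32`. -/
theorem su2_dim3_uniformMassGapOnBallZdG_star_linear (Kn : ℕ) {βW ε₀ ε₁ c lam E S ρ₀ : ℝ} (hβ0 : 0 ≤ βW)
    (hβ : βW ≤ 2 / 3) (hε₁ : 0 ≤ ε₁) (hE : Real.exp ε₀ ≤ E) (hS : Real.sqrt 2 ≤ S)
    (hc : E * (1 + 2 * S * ε₁) * (βW / 4) ≤ c) (hlam : S * ε₁ ≤ lam) (hθ1 : 4 * c + lam < 1) (hcd : doorPoly 3 c < 1)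
    (hρ0 : gaugeR 3 c + (lam + (4 * c + lam) ^ Kn * (12 * lam)) / (1 - (4 * c + lam)) ≤ ρ₀) (hhalf : 1 / 2 ≤ ρ₀)
    (hρ1 : ρ₀ < 1) (R : ℕ) :
    UniformMassGapOnBallZdG 3 2 (βW / 4) ε₀ ε₁ R ((1 - ρ₀) / (max R 1 + 4 : ℕ)) 32 := by
  have h := su2_dim3_uniformMassGapOnBallZdG_star_geometric Kn hβ0 hβ hε₁ hE hS hc hlam hθ1 hcd hρ0 hρ1 R
  have hD : (0 : ℝ) < ((max R 1 + 4 : ℕ) : ℝ) := by positivity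
  have hmax : max ρ₀ (1 / 2) = ρ₀ := max_eq_left hhalf
  have hrate : 1 - ρ₀ ≤ -Real.log (max ρ₀ (1 / 2)) := by
    have := one_sub_le_neg_log_max_half (ρ := ρ₀); rwa [hmax] at this ⊢
  exact h.mono le_rfl le_rfl le_rfl (div_pos (by linarith) hD) (div_le_div_of_nonneg_right hrate hD.le) le_rfl
    (by norm_num)

/-- **`ℤ³` CELL `β_W = 1/4`, QUARTER RADIUS `(57/1000, 57/2000)`**: received sum `≤ 43/100 ≤ 1/2` ⇒
`UniformMassGapOnBallZdG 3 2 (1/16) (57/1000) (57/2000) R (log 2/(max R 1 + 4)) 32` (tree: rate `1/38`, constant `64`). -/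
theorem su2_dim3_uniformStar_oneQuarter_quarterRadius_geometric (R : ℕ) :
    UniformMassGapOnBallZdG 3 2 (1 / 16) (57 / 1000) (57 / 2000) R (Real.log 2 / (max R 1 + 4 : ℕ)) 32 := by
  have e1 : (1 / 4 : ℝ) / 4 = 1 / 16 := by norm_num
  have h := su2_dim3_uniformMassGapOnBallZdG_star_geometric 20 (βW := 1 / 4) (ε₀ := 57 / 1000) (ε₁ := 57 / 2000)
    (c := 143 / 2000) (lam := 20153 / 500000) (ρ₀ := 43 / 100) (by norm_num) (by norm_num) (by norm_num)
    (exp_le_taylor4 (x := 57 / 1000) (by norm_num) (by norm_num)) sqrt_two_le (by norm_num) (by norm_num)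
    (by norm_num) (by unfold doorPoly; norm_num) (by unfold gaugeR Delta; norm_num) (by norm_num) R
  rw [e1] at h
  have hlog : -Real.log (max (43 / 100 : ℝ) (1 / 2)) = Real.log 2 := by
    rw [show max (43 / 100 : ℝ) (1 / 2) = 1 / 2 by norm_num, one_div, Real.log_inv, neg_neg]
  rw [hlog] at h
  exact h

/-- **`ℤ³` CELL `β_W = 1/4`, HALF RADIUS `(57/500, 57/1000)`**: received sum `≤ 57/100` ⇒ rate `log(100/57)/(max R 1 + 4)`
(`≈ 0.562/…`; tree: `1/85`), constant `32`. -/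
theorem su2_dim3_uniformStar_oneQuarter_halfRadius_geometric (R : ℕ) :
    UniformMassGapOnBallZdG 3 2 (1 / 16) (57 / 500) (57 / 1000) R (Real.log (100 / 57) / (max R 1 + 4 : ℕ)) 32 := by
  have e1 : (1 / 4 : ℝ) / 4 = 1 / 16 := by norm_num
  have h := su2_dim3_uniformMassGapOnBallZdG_star_geometric 20 (βW := 1 / 4) (ε₀ := 57 / 500) (ε₁ := 57 / 1000)
    (c := 81341 / 1000000) (lam := 80611 / 1000000) (ρ₀ := 57 / 100) (by norm_num) (by norm_num) (by norm_num)
    (exp_le_taylor4 (x := 57 / 500) (by norm_num) (by norm_num)) sqrt_two_le (by norm_num) (by norm_num)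
    (by norm_num) (by unfold doorPoly; norm_num) (by unfold gaugeR Delta; norm_num) (by norm_num) R
  rw [e1] at h
  have hlog : -Real.log (max (57 / 100 : ℝ) (1 / 2)) = Real.log (100 / 57) := by
    rw [show max (57 / 100 : ℝ) (1 / 2) = 57 / 100 by norm_num, ← Real.log_inv]; norm_num
  rw [hlog] at h
  exact h

/-- **`ℤ³`, UP TO `β_W = 1/2`, ONE EXPLICIT RATE `(1/200)/(max R 1 + 4)`** and constant `32` for every `0 ≤ β_W ≤ 1/2`, every member
of `MemBallZdG (17/500) (17/1000) R` and every DLR state (received sum `≤ 199/200` along the segment; tree: `∃ m > 0`). -/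
theorem su2_dim3_uniformStar_upTo_oneHalf_geometric {βW : ℝ} (h0 : 0 ≤ βW) (h : βW ≤ 1 / 2) (R : ℕ) :
    UniformMassGapOnBallZdG 3 2 (βW / 4) (17 / 500) (17 / 1000) R ((1 / 200 : ℝ) / (max R 1 + 4 : ℕ)) 32 := by
  have e2 : (1 : ℝ) - 199 / 200 = 1 / 200 := by norm_num
  rw [← e2]
  refine su2_dim3_uniformMassGapOnBallZdG_star_linear 20 (ε₀ := 17 / 500) (ε₁ := 17 / 1000) (c := 67771 / 500000)
    (lam := 12021 / 500000) (E := 206917 / 200000) (S := 1.41422) (ρ₀ := 199 / 200) h0 (h.trans (by norm_num)) (by norm_num)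
    exp_le_17_500_star sqrt_two_le ?_ (by norm_num) (by norm_num) (by unfold doorPoly; norm_num)
    (by unfold gaugeR Delta; norm_num) (by norm_num) (by norm_num) R
  calc (206917 / 200000 : ℝ) * (1 + 2 * 1.41422 * (17 / 1000)) * (βW / 4)
      ≤ 206917 / 200000 * (1 + 2 * 1.41422 * (17 / 1000)) * ((1 / 2) / 4) := by gcongr
    _ ≤ 67771 / 500000 := by norm_num

/-- **THE `ℤ³` WILSON POINT, `SU(2)`, `0 ≤ β_W ≤ 1/2`, EXPLICIT RATE**: every DLR state of `SU(2)` lattice Yang–Mills on `ℤ³` at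
`β_W ≤ 1/2` clusters with `PerturbedClustering 3 2 (β_W/4) 0 ∅ ((1/200)/5) 32`. -/
theorem su2_dim3_wilson_clustering_upTo_oneHalf_explicit {βW : ℝ} (h0 : 0 ≤ βW) (h : βW ≤ 1 / 2) :
    PerturbedClustering 3 2 (βW / 4) 0 (fun _ => (∅ : Finset (Finset (ZdEdge 3)))) ((1 / 200 : ℝ) / 5) 32 := by
  have hball := su2_dim3_uniformStar_upTo_oneHalf_geometric h0 h 0
  have e5 : ((max 0 1 + 4 : ℕ) : ℝ) = 5 := by norm_num
  rw [e5] at hball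
  exact (hball.2 0 _ (memBallZdG_zero (by norm_num) (by norm_num) 0)).2

/-! ### Every `N ≥ 2`, `d = 4`: the eigen modulus; `SU(3)` hypothesis-free cells -/

/-- **SCHEMA, every `N ≥ 2`, `d = 4`, eigen modulus, GEOMETRIC RATE** (hypotheses of `suN_uniformMassGapOnBallZdG_star_eigen`):
`UniformMassGapOnBallZdG 4 N (β_W/N²) ε₀ ε₁ R (log(1/max(ρ₀,½))/(max R 1 + 4)) (16N)`. -/
theorem suN_uniformMassGapOnBallZdG_star_eigen_geometric (Kn : ℕ) {N : ℕ} (hN : 2 ≤ N) {βW ε₀ ε₁ c lam E S Kb ρ₀ : ℝ}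
    (hβ0 : 0 ≤ βW) (hR : βW / (N : ℝ) ^ 2 * 6 < 1 / 2) (hε₁ : 0 ≤ ε₁) (hE : Real.exp ε₀ ≤ E)
    (hS : Real.sqrt N ≤ S) (hKb : (N : ℝ) ^ 2 / ((N : ℝ) ^ 2 - 1) * ((1 / 2 + 2 * (βW / (N : ℝ) ^ 2 * 6)) /
      (1 / 2 - βW / (N : ℝ) ^ 2 * 6)) ≤ Kb)
    (hc : Kb * E * (1 + 2 * S * ε₁) * (βW / (N : ℝ) ^ 2) ≤ c) (hlam : S * ε₁ ≤ lam) (hθ1 : 6 * c + lam < 1)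
    (hcd : doorPoly 4 c < 1)
    (hρ0 : gaugeR 4 c + (lam + (6 * c + lam) ^ Kn * (16 * lam)) / (1 - (6 * c + lam)) ≤ ρ₀) (hρ1 : ρ₀ < 1)
    (R : ℕ) :
    UniformMassGapOnBallZdG 4 N (βW / (N : ℝ) ^ 2) ε₀ ε₁ R (-Real.log (max ρ₀ (1 / 2)) / (max R 1 + 4 : ℕ)) (16 * N) := by
  -- adapted from `suN_uniformMassGapOnBallZdG_star_eigen`
  have hN1 : 1 ≤ N := by omega
  have hNpos : (0 : ℝ) < N := by exact_mod_cast (show 0 < N by omega)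
  have hN2 : (2 : ℝ) ≤ N := by exact_mod_cast hN
  set Rm : ℝ := βW / (N : ℝ) ^ 2 * 6 with hRdef
  set K : ℝ := (N : ℝ) ^ 2 / ((N : ℝ) ^ 2 - 1) * ((1 / 2 + 2 * Rm) / (1 / 2 - Rm)) with hKdef
  have hmod : OneLinkKRModulus N Rm K := OneLinkEigen.oneLinkKRModulus_eigen hN hR
  have hK0 : 0 ≤ K := by
    have h1 : (0 : ℝ) < (N : ℝ) ^ 2 - 1 := by nlinarith
    have h2 : (0 : ℝ) < 1 / 2 - Rm := by linarith
    positivity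
  have hS0 : 0 ≤ S := (Real.sqrt_nonneg _).trans hS
  have hE0 : 0 ≤ E := (Real.exp_pos _).le.trans hE
  have hKb0 : 0 ≤ Kb := hK0.trans hKb
  set θ : ℝ := 6 * c + lam with hθ
  set ρ : ℝ := gaugeR 4 c + (lam + θ ^ Kn * (16 * lam)) / (1 - θ) with hρ
  have habs : |(N : ℝ) * (βW / (N : ℝ) ^ 2)| / (N : ℝ) = βW / (N : ℝ) ^ 2 := by
    rw [abs_of_nonneg (by positivity)]
    field_simp
  have hR' : |(N : ℝ) * (βW / (N : ℝ) ^ 2)| / (N : ℝ) * (2 * (((4 : ℕ) : ℝ) - 1)) ≤ Rm := by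
    rw [habs, hRdef]; norm_num
  have hc' : K * Real.exp ε₀ * (1 + 2 * Real.sqrt N * ε₁) * (|(N : ℝ) * (βW / (N : ℝ) ^ 2)| / (N : ℝ)) ≤ c := by
    refine le_trans ?_ hc
    rw [habs]
    have hb : 0 ≤ βW / (N : ℝ) ^ 2 := by positivity
    have h2 : 1 + 2 * Real.sqrt N * ε₁ ≤ 1 + 2 * S * ε₁ := by nlinarith
    have h3 : 0 ≤ 1 + 2 * Real.sqrt N * ε₁ := by positivity
    calc K * Real.exp ε₀ * (1 + 2 * Real.sqrt N * ε₁) * (βW / (N : ℝ) ^ 2)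
        ≤ Kb * E * (1 + 2 * Real.sqrt N * ε₁) * (βW / (N : ℝ) ^ 2) := by gcongr
      _ ≤ Kb * E * (1 + 2 * S * ε₁) * (βW / (N : ℝ) ^ 2) := by gcongr
  have hlam' : Real.sqrt N * ε₁ ≤ lam := le_trans (mul_le_mul_of_nonneg_right hS hε₁) hlam
  have hθ' : θ = (2 * ((4 : ℕ) : ℝ) - 2) * c + lam := by rw [hθ]; push_cast; ring
  have hρ' : ρ = gaugeR 4 c + (lam + θ ^ Kn * (4 * ((4 : ℕ) : ℝ) * lam)) / (1 - θ) := by rw [hρ]; push_cast; ring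
  exact uniformMassGapOnBallZdG_of_robustStar_geometric (d := 4) (N := N) (by norm_num) hN1 hK0 hR' hmod hε₁ hc' hlam' hθ'
    hθ1 hcd hρ' hρ0 hρ1

/-- **CELL `SU(3)`, `β_W = 1/8` ('t Hooft `1/72`), QUARTER RADIUS `(37/500, 37/1000)`, HYPOTHESIS-FREE**: received sum `≤ 31/100 ≤ 1/2` ⇒
`UniformMassGapOnBallZdG 4 3 (1/72) (37/500) (37/1000) R (log 2/(max R 1 + 4)) 48` (tree: rate `1/26`, constant `96`). -/
theorem su3_uniformStar_oneEighth_quarterRadius_geometric (R : ℕ) :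
    UniformMassGapOnBallZdG 4 3 (1 / 72) (37 / 500) (37 / 1000) R (Real.log 2 / (max R 1 + 4 : ℕ)) 48 := by
  have e1 : (1 / 8 : ℝ) / ((3 : ℕ) : ℝ) ^ 2 = 1 / 72 := by norm_num
  have hS : Real.sqrt ((3 : ℕ) : ℝ) ≤ 1.73206 := by
    have : ((3 : ℕ) : ℝ) = 3 := by norm_num
    rw [this]; exact sqrt_three_le
  have h := suN_uniformMassGapOnBallZdG_star_eigen_geometric 20 (N := 3) (by norm_num) (βW := 1 / 8) (ε₀ := 37 / 500)
    (ε₁ := 37 / 1000) (c := 30371 / 1000000) (lam := 64087 / 1000000) (S := 1.73206) (Kb := 9 / 5) (ρ₀ := 31 / 100)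
    (by norm_num) (by norm_num) (by norm_num) (exp_le_taylor4 (x := 37 / 500) (by norm_num) (by norm_num)) hS (by norm_num)
    (by norm_num) (by norm_num) (by norm_num) (by unfold doorPoly; norm_num) (by unfold gaugeR Delta; norm_num) (by norm_num) R
  rw [e1] at h
  have hlog : -Real.log (max (31 / 100 : ℝ) (1 / 2)) = Real.log 2 := by
    rw [show max (31 / 100 : ℝ) (1 / 2) = 1 / 2 by norm_num, one_div, Real.log_inv, neg_neg]
  have h48 : (16 * ((3 : ℕ) : ℝ) : ℝ) = 48 := by norm_num
  rw [hlog, h48] at h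
  exact h

/-- **CELL `SU(3)`, `β_W = 1/8`, HALF RADIUS `(37/250, 37/500)`, HYPOTHESIS-FREE**: received sum `≤ 47/100 ≤ 1/2` ⇒ rate `log 2/(max R 1 + 4)`
(tree: `1/61`), constant `48`. -/
theorem su3_uniformStar_oneEighth_halfRadius_geometric (R : ℕ) :
    UniformMassGapOnBallZdG 4 3 (1 / 72) (37 / 250) (37 / 500) R (Real.log 2 / (max R 1 + 4 : ℕ)) 48 := by
  have e1 : (1 / 8 : ℝ) / ((3 : ℕ) : ℝ) ^ 2 = 1 / 72 := by norm_num
  have hS : Real.sqrt ((3 : ℕ) : ℝ) ≤ 1.73206 := by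
    have : ((3 : ℕ) : ℝ) = 3 := by norm_num
    rw [this]; exact sqrt_three_le
  have h := suN_uniformMassGapOnBallZdG_star_eigen_geometric 20 (N := 3) (by norm_num) (βW := 1 / 8) (ε₀ := 37 / 250)
    (ε₁ := 37 / 500) (c := 36419 / 1000000) (lam := 128173 / 1000000) (S := 1.73206) (Kb := 9 / 5) (ρ₀ := 47 / 100)
    (by norm_num) (by norm_num) (by norm_num) (exp_le_taylor4 (x := 37 / 250) (by norm_num) (by norm_num)) hS (by norm_num)
    (by norm_num) (by norm_num) (by norm_num) (by unfold doorPoly; norm_num) (by unfold gaugeR Delta; norm_num) (by norm_num) R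
  rw [e1] at h
  have hlog : -Real.log (max (47 / 100 : ℝ) (1 / 2)) = Real.log 2 := by
    rw [show max (47 / 100 : ℝ) (1 / 2) = 1 / 2 by norm_num, one_div, Real.log_inv, neg_neg]
  have h48 : (16 * ((3 : ℕ) : ℝ) : ℝ) = 48 := by norm_num
  rw [hlog, h48] at h
  exact h

/-! ### The PV2 variance form: `SU(3)` hypothesis-free up to `β_W = 17/50` -/

/-- **SCHEMA, `SU(3)`, `d = 4`, HYPOTHESIS-FREE, PV2 variance form, free modulus radius, LINEAR READING** (hypotheses of engine-2's
`su3_massGapOnBallZdG_pv2Star_rad`, round bound `… ≤ ρ₀`, `1/2 ≤ ρ₀ < 1`):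
`UniformMassGapOnBallZdG 4 3 (β_W/9) ε₀ ε₁ R ((1 − ρ₀)/(max R 1 + 4)) 48`. -/
theorem su3_uniformMassGapOnBallZdG_pv2Star_rad_linear (Kn : ℕ) {βW ε₀ ε₁ c lam E E₂ τ Ks Sq Rm ρ₀ : ℝ} (hβ0 : 0 ≤ βW)
    (hRm : βW / 9 * 6 ≤ Rm) (hR : Rm < 1 / 2) (hε₁ : 0 ≤ ε₁) (hE : Real.exp ε₀ ≤ E) (hE₂ : Real.exp (ε₀ / 2) ≤ E₂) (hτ : 1 < τ)
    (hKs0 : 0 ≤ Ks) (hKs : 16 * τ * (τ - 1) + 9 * τ ^ 3 * Rm ^ 2 ≤ 16 * (τ - 1) * (Ks ^ 2 * (1 / 2 - Rm)))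
    (hSq0 : 0 ≤ Sq) (hSq : 1 ≤ 3 * Sq ^ 2 * (1 / 2 - Rm)) (hc : E * Ks * (βW / 9) ≤ c)
    (hlam : E₂ * Sq * ε₁ ≤ lam) (hθ1 : 6 * c + lam < 1) (hcd : doorPoly 4 c < 1)
    (hρ0 : gaugeR 4 c + (lam + (6 * c + lam) ^ Kn * (16 * lam)) / (1 - (6 * c + lam)) ≤ ρ₀) (hhalf : 1 / 2 ≤ ρ₀)
    (hρ1 : ρ₀ < 1) (Rr : ℕ) :
    UniformMassGapOnBallZdG 4 3 (βW / 9) ε₀ ε₁ Rr ((1 - ρ₀) / (max Rr 1 + 4 : ℕ)) 48 := by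
  obtain ⟨hP, hV, h1, h2⟩ := su3_pv2_star_inputs (x := βW / 9) hR hτ hε₁ (by positivity) hE hE₂ hKs0 hKs hSq0 hSq
  have htN : |((3 : ℕ) : ℝ) * (βW / 9)| / ((3 : ℕ) : ℝ) = βW / 9 := by
    rw [abs_of_nonneg (by positivity)]; field_simp
  have hb' : |((3 : ℕ) : ℝ) * (βW / 9)| / ((3 : ℕ) : ℝ) * (2 * (((4 : ℕ) : ℝ) - 1)) ≤ Rm := by
    rw [htN]; norm_num; linarith
  have hc' : Real.exp ε₀ * Real.sqrt (1 / (3 * (1 / 2 - Rm)) * (3 * (1 / 2 - Rm) * Ks ^ 2)) *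
      (|((3 : ℕ) : ℝ) * (βW / 9)| / ((3 : ℕ) : ℝ)) ≤ c := by
    rw [htN]; exact h1.trans hc
  have hθ' : (6 : ℝ) * c + lam = (2 * ((4 : ℕ) : ℝ) - 2) * c + lam := by push_cast; ring
  have hρ' : gaugeR 4 c + (lam + (6 * c + lam) ^ Kn * (16 * lam)) / (1 - (6 * c + lam)) =
      gaugeR 4 c + (lam + (6 * c + lam) ^ Kn * (4 * ((4 : ℕ) : ℝ) * lam)) / (1 - (6 * c + lam)) := by push_cast; ring
  have h48 : (16 * ((3 : ℕ) : ℝ) : ℝ) = 48 := by norm_num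
  rw [← h48]
  have key := uniformMassGapOnBallZdG_of_robustStar_variance_geometric (d := 4) (N := 3) (by norm_num) (by norm_num) (Kn := Kn)
    (by positivity) (by positivity) hb' hP hV hε₁ hc' (h2.trans hlam) hθ' hθ1 hcd hρ' hρ0 hρ1 (R := Rr)
  have hD : (0 : ℝ) < ((max Rr 1 + 4 : ℕ) : ℝ) := by positivity
  have hmax : max ρ₀ (1 / 2) = ρ₀ := max_eq_left hhalf
  have hrate : 1 - ρ₀ ≤ -Real.log (max ρ₀ (1 / 2)) := by
    have := one_sub_le_neg_log_max_half (ρ := ρ₀); rwa [hmax] at this ⊢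
  exact key.mono le_rfl le_rfl le_rfl (div_pos (by linarith) hD) (div_le_div_of_nonneg_right hrate hD.le) le_rfl
    (by positivity)

/-- **`SU(3)`, `ℤ⁴`, HYPOTHESIS-FREE — ONE EXPLICIT RATE `(1/250)/(max R 1 + 4)` FOR THE WHOLE SEGMENT `0 ≤ β_W ≤ 17/50`** on
`MemBallZdG (11/500) (11/1000) R`, constant `48` (engine-2's certificate at the fixed modulus radius `17/75`; received sum `≤ 249/250`;
tree: `∃ m > 0` via the `starRate` schema). -/
theorem su3_uniformStar_pv2_upTo_seventeenFiftieths_geometric {βW : ℝ} (h0 : 0 ≤ βW) (h : βW ≤ 17 / 50) (R : ℕ) :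
    UniformMassGapOnBallZdG 4 3 (βW / 9) (11 / 500) (11 / 1000) R ((1 / 250 : ℝ) / (max R 1 + 4 : ℕ)) 48 := by
  have e2 : (1 : ℝ) - 249 / 250 = 1 / 250 := by norm_num
  rw [← e2]
  have hc : (255561 / 250000 : ℝ) * (229679 / 100000) * (βW / 9) ≤ 44349 / 500000 := by
    have h1 : (255561 / 250000 : ℝ) * (229679 / 100000) * (βW / 9) ≤
        (255561 / 250000 : ℝ) * (229679 / 100000) * ((17 / 50 : ℝ) / 9) :=
      mul_le_mul_of_nonneg_left (by linarith) (by norm_num)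
    exact h1.trans (by norm_num)
  exact su3_uniformMassGapOnBallZdG_pv2Star_rad_linear 20 (βW := βW) (ε₀ := 11 / 500) (ε₁ := 11 / 1000) (c := 44349 / 500000)
    (lam := 6141 / 500000) (E := 255561 / 250000) (E₂ := 1011061 / 1000000) (τ := 581 / 500) (Ks := 229679 / 100000)
    (Sq := 276079 / 250000) (Rm := 17 / 75) (ρ₀ := 249 / 250) h0 (by linarith) (by norm_num) (by norm_num)
    (by refine (Real.exp_bound' (x := 11 / 500) (by norm_num) (by norm_num) (n := 5) (by norm_num)).trans ?_
        simp only [Finset.sum_range_succ, Finset.sum_range_zero, Nat.factorial]; norm_num)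
    (by refine (Real.exp_bound' (x := 11 / 500 / 2) (by norm_num) (by norm_num) (n := 5) (by norm_num)).trans ?_
        simp only [Finset.sum_range_succ, Finset.sum_range_zero, Nat.factorial]; norm_num)
    (by norm_num) (by norm_num) (by norm_num) (by norm_num) (by norm_num) hc (by norm_num) (by norm_num) (by unfold doorPoly; norm_num)
    (by unfold gaugeR Delta; norm_num) (by norm_num) (by norm_num) R

/-- **THE `SU(3)` WILSON POINT ON `ℤ⁴`, `0 ≤ β_W ≤ 17/50`, HYPOTHESIS-FREE, EXPLICIT RATE**: every DLR state of `SU(3)` lattice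
Yang–Mills at `β_W ≤ 17/50` ('t Hooft `β_W/9`) clusters with `PerturbedClustering 4 3 (β_W/9) 0 ∅ ((1/250)/5) 48`. -/
theorem su3_wilson_clustering_upTo_seventeenFiftieths_explicit {βW : ℝ} (h0 : 0 ≤ βW) (h : βW ≤ 17 / 50) :
    PerturbedClustering 4 3 (βW / 9) 0 (fun _ => (∅ : Finset (Finset (ZdEdge 4)))) ((1 / 250 : ℝ) / 5) 48 := by
  have hball := su3_uniformStar_pv2_upTo_seventeenFiftieths_geometric h0 h 0
  have e5 : ((max 0 1 + 4 : ℕ) : ℝ) = 5 := by norm_num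
  rw [e5] at hball
  exact (hball.2 0 _ (memBallZdG_zero (by norm_num) (by norm_num) 0)).2

end Summit.Ventures.YMGap.RobustBall

end
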